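import Summits.NavierStokesRegularity.NavierStokesRegularity.Theorems.SoloSalvageWu2026PressureWeak
import Summits.NavierStokesRegularity.NavierStokesRegularity.Theorems.SoloSalvageWu2026PressureConst
import Summits.NavierStokesRegularity.NavierStokesRegularity.Theorems.SoloSalvageWu2026BiotSavart
import Summits.NavierStokesRegularity.NavierStokesRegularity.Theorems.SoloSalvageWu2026Step385
import HarnessLib

/-!
# C177 `Wu2026` — TRUE column: `Step_341` (§3.3 canonical pressure, (3.36) + (3.41)) HOLDS
# (D-0154 (2) INPUTS, director-ns req136, seat `ns-in-wu-341`; filed in the salvage namespace)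

The binder `Literature.Claims.NS.Wu2026.Step_341` of the claim skeleton (arXiv:2608.22471v1, §3.3
p.14 l.6 – p.15 l.7): for every `IsWuFlow ν v p` (`ν > 0`) with `D(v) < ∞` and `v ∈ L^{9/2,∞}` there is
a constant `c` with `p − c ∈ L^{9/4,∞}(ℝ³)` and `𝒬 = (p − c) + |v|²/2 ∈ L^{9/4,∞}(ℝ³)`.

Assembly of the three helper files of this seat:
* `SoloSalvageWu2026PressureConst` — (3.36): `∃ c, p − c = p̃[v]` a.e., `p̃ = normalisedPressure` the
  canonical Riesz-transform pressure (harmonic normalisation; needs `v ∈ L^{15/2}`);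
* `SoloSalvageWu2026PressureWeak` — (3.41) first summand: `v ∈ L^{9/2,∞} ⇒ p̃[v] ∈ L^{9/4,∞}` (real
  interpolation of the tree's Calderón–Zygmund bounds; needs `v ∈ L⁶`);
* `SoloSalvageWu2026WeakLpAlgebra` — (3.41) second summand: `(p − c) + |v|²/2 ∈ L^{9/4,∞}`.
The Lebesgue memberships `v ∈ L^{15/2}`, `v ∈ L⁶` come from `v ∈ L^{9/2,∞} ∩ L^∞` (`v` continuous with
`v → 0` at infinity is bounded; `MemWeakLp.memLp_of_norm_le`). The hypothesis `D(v) < ∞` of the binder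
is not used (the print uses it only to fix `c = 0` in `‖v − c‖_{L⁶} ≤ C‖∇v‖_{L²}`, which the tree's
route through `L^{9/2,∞} ∩ L^∞` does not need).

* `exists_forall_norm_le_of_decay`, `memLp_of_isWuFlow` — boundedness and `L^q`-membership,
  `9/2 < q < ∞`, of the velocity of an `IsWuFlow` with `v ∈ L^{9/2,∞}`;
* `exists_pressure_sub_const_ae_eq_normalisedPressure` — (3.36) for the class;
* `step_341 : Step_341` — **the binder holds exactly as typed**.

With `step_341` the named fact `Wu2026_thm11` follows from TWO open binders:
`wu2026_thm11_of_four_open_steps step_341 hcon hP33 step_385` (`Step_construct`, `Step_P33`; seats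
`ns-in-wu-con`, `ns-in-wu-p33`) — recorded as `wu2026_thm11_of_two_open_steps`.

WHAT THIS IS NOT: not a claim about NS regularity or blow-up; not a claim about any author beyond the
typed locator; a printed step is re-proved as typed; item 0897 (`GaldiLiouvilleGate.CriticalRateLiouville`)
stays conditional on `Step_construct` and `Step_P33`.
-/

noncomputable section

set_option linter.dupNamespace false

open MeasureTheory Set Function Filter Topology Metric
open scoped ENNReal NNReal RealInnerProductSpace

namespace Summit.NavierStokesRegularity.NavierStokesRegularity.Theorems.Wu2026Salvage

open Literature.Claims.NS.Wu2026 Literature.Analysis.FluidPDE Literature.Analysis.FunctionSpaces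

/-- A continuous field tending to `0` at infinity is bounded (by a positive constant). [folklore] -/
theorem exists_forall_norm_le_of_decay {v : E3 → E3} (hv : Continuous v)
    (hdec : Tendsto v (cocompact E3) (𝓝 0)) : ∃ M : ℝ, 0 < M ∧ ∀ x, ‖v x‖ ≤ M := by
  have hK : IsCompact (insert (0 : E3) (range v)) := hdec.isCompact_insert_range_of_cocompact hv
  obtain ⟨M, hM0, hM⟩ := (hK.isBounded.subset (subset_insert _ _)).exists_pos_norm_le
  exact ⟨M, hM0, fun x => hM (v x) (mem_range_self x)⟩

/-- **`v ∈ L^{9/2,∞} ∩ L^∞ ⊂ L^q`, `9/2 < q < ∞`**, for the velocity of an `IsWuFlow` (continuous,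
`v → 0` at infinity, hence bounded) with `v ∈ L^{9/2,∞}` (Lemma 2.1 (2.3)). [cite: Wu2026, Lemma 2.1 (2.3) p.5; (3.17) p.9] -/
theorem memLp_of_isWuFlow {ν : ℝ} {v : E3 → E3} {p : E3 → ℝ} (hf : IsWuFlow ν v p)
    (hvw : MemWeakLp v ((9 : ℝ≥0∞) / 2) volume) {q : ℝ≥0∞} (hq : (9 : ℝ≥0∞) / 2 < q)
    (hqt : q ≠ ⊤) : MemLp v q volume := by
  obtain ⟨M, hM0, hM⟩ := exists_forall_norm_le_of_decay hf.smooth_v.continuous hf.decay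
  exact MemWeakLp.memLp_of_norm_le hvw hM0 hM hq hqt

/-- **(3.36): the pressure of an `IsWuFlow` with `v ∈ L^{9/2,∞}` is the canonical pressure up to a
constant**: `∃ c, p − c = p̃[v]` a.e. («Thus the original pressure and p_can differ only by one
constant. After changing the original pressure by this constant, we write from now on
p = p_can = R_iR_k(v_iv_k)», p.14 l.40–45) — `exists_pressure_sub_normalisedPressure_ae_eq_const` with
`v ∈ L^{15/2} = L^{2·(15/4)}`. [cite: Wu2026, (3.36) p.14 l.29–45] -/
theorem exists_pressure_sub_const_ae_eq_normalisedPressure {ν : ℝ} {v : E3 → E3} {p : E3 → ℝ}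
    (hf : IsWuFlow ν v p) (hvw : MemWeakLp v ((9 : ℝ≥0∞) / 2) volume) :
    ∃ c : ℝ, (fun x => p x - c) =ᵐ[volume] normalisedPressure v := by
  have hlt : (9 : ℝ≥0∞) / 2 < 2 * (15 / 4) := by
    rw [ENNReal.div_lt_iff (Or.inl (by norm_num)) (Or.inl (by norm_num)),
      show (2 : ℝ≥0∞) * (15 / 4) * 2 = 15 / 4 * 4 by ring,
      ENNReal.div_mul_cancel (by norm_num) (by norm_num)]
    norm_num
  have hne : (2 * (15 / 4) : ℝ≥0∞) ≠ ⊤ :=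
    ENNReal.mul_ne_top (by norm_num) (ENNReal.div_lt_top (by norm_num) (by norm_num)).ne
  have h15 : MemLp v (2 * (15 / 4 : ℝ≥0∞)) volume := memLp_of_isWuFlow hf hvw hlt hne
  obtain ⟨c, hc⟩ := exists_pressure_sub_normalisedPressure_ae_eq_const hf.profile h15
  refine ⟨c, ?_⟩
  filter_upwards [hc] with x hx
  show p x - c = normalisedPressure v x
  linarith

/-- **`Step_341` holds** ((3.36) + (3.41), p.14 l.6 – p.15 l.7: «p = p_can = R_iR_k(v_iv_k) … Since
v ∈ L^{9/2,∞}, we have v ⊗ v ∈ L^{9/4,∞}, and the boundedness of Riesz transforms on Lorentz spaces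
gives ‖p‖_{L^{9/4,∞}(R³)} + ‖p + |v|²/2‖_{L^{9/4,∞}(R³)} ≤ C. (3.41)»): the constant of
`exists_pressure_sub_const_ae_eq_normalisedPressure`, the weak-type bound
`memWeakLp_normalisedPressure_nine_fourths` transported along the a.e. identity, and
`memWeakLp_add_half_norm_sq` for the Bernoulli function. The hypothesis `dirichlet v < ∞` is not
used. [cite: Wu2026, (3.36)/(3.41) p.14–15] -/
theorem step_341 : Step_341 := by
  intro ν _hν v p hf _hD hvw
  have h92 : ((9 : ℝ≥0∞) / 2).toReal = 9 / 2 := by rw [ENNReal.toReal_div]; norm_num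
  have h94 : ((9 : ℝ≥0∞) / 4).toReal = 9 / 4 := by rw [ENNReal.toReal_div]; norm_num
  -- `v ∈ L⁶ = L^{2·3}`
  have hlt6 : (9 : ℝ≥0∞) / 2 < 2 * 3 := by
    rw [ENNReal.div_lt_iff (Or.inl (by norm_num)) (Or.inl (by norm_num))]
    norm_num
  have hv6 : MemLp v (2 * 3) volume := memLp_of_isWuFlow hf hvw hlt6 (by norm_num)
  -- the canonical pressure is weak-`L^{9/4}`
  have hPw : MemWeakLp (normalisedPressure v) ((9 : ℝ≥0∞) / 4) volume :=
    memWeakLp_normalisedPressure_nine_fourths hf.smooth_v.continuous hvw hv6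
  -- the constant
  obtain ⟨c, hc⟩ := exists_pressure_sub_const_ae_eq_normalisedPressure hf hvw
  have h1 : MemWeakLp (fun x => p x - c) ((9 : ℝ≥0∞) / 4) volume := MemWeakLp.congr_ae hPw hc.symm
  refine ⟨c, h1, ?_⟩
  -- the Bernoulli function `(p - c) + |v|²/2`
  have h2 := memWeakLp_add_half_norm_sq (μ := volume) h1 hvw (by rw [h92, h94]; norm_num)
    (by rw [h94]; norm_num)
  change MemWeakLp (fun y => (p y - c) + ‖v y‖ ^ 2 / 2) ((9 : ℝ≥0∞) / 4) volume
  exact h2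

/-- `_holds`-named alias of `step_341` (D-0014 discharge convention for the named binder
`Literature.Claims.NS.Wu2026.Step_341`). [cite: Wu2026, (3.36)/(3.41) p.14–15] -/
theorem Step_341_holds : Step_341 := step_341

/-- **Theorem 1.1 of arXiv:2608.22471v1 from the TWO steps not yet ported** (§3.2–§3.4 tangent
construction `Step_construct`, Prop 3.3 `Step_P33`); every other binder of the skeleton's composition
is a kernel theorem (`step_L21`, `step_33`, `step_38`, `step_318`, `step_341` (this file), `step_P34`,
`step_382`, `step_385`, `step_386`, `step_387`, `step_L31_holds`, `step_D0_holds`). Nothing here asserts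
either of the two. [cite: Wu2026, Thm 1.1 p.2 l.30–37; proof §3 p.7–26] -/
theorem wu2026_thm11_of_two_open_steps (hcon : Step_construct) (hP33 : Step_P33) :
    Literature.Analysis.FluidPDE.Wu2026_thm11 :=
  wu2026_thm11_of_four_open_steps step_341 hcon hP33 step_385

/-- The same for Corollary 1.2 (the tree's `Wu2026_cor12`). [cite: Wu2026, Cor 1.2 p.2 l.42–56] -/
theorem wu2026_cor12_of_two_open_steps (hcon : Step_construct) (hP33 : Step_P33) :
    Literature.Analysis.FluidPDE.Wu2026_cor12 :=
  wu2026_cor12_of_four_open_steps step_341 hcon hP33 step_385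

end Summit.NavierStokesRegularity.NavierStokesRegularity.Theorems.Wu2026Salvage

end

-- WHAT THIS IS NOT: not a claim about NS regularity or blow-up; not a claim about any author beyond the typed locator.
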